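import Mathlib.Data.ENNReal.Inv
import Literature.MathematicalPhysics.QuantumManyBody.BoseEinsteinCondensation
import Summits.AtomisticToContinuum.BoseEinsteinCondensation.Theorems.BECHardSphereReductionHardCoreDominatesCutToHardCoreOf
import HarnessLib

/-!
# BECHardSphereReduction / HardCoreDominates — lower semicontinuity of the condensate number
# along the coupling path (stub `stub_pathLsc` of line `birth`, skeleton v6)

Crux `HardCoreDominates` (stmt-AtomisticToContinuum-11884) of route `BECHardSphereReduction`,
line `birth`: the coupling path `v_t = v + t·1_{Iic R}` (`t : ℝ≥0`) from a pair potential `v`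
to the hard spheres `HS_R = ⊤·1_{Iic R}`.

This file proves the registered stub `stub_pathLsc`: for every profile `v`, range marker `R`,
particle number `N`, side `L` and coupling `t₀`, the map `t ↦ condensateNumber v_t N L` is lower
semicontinuous at `t₀` in neighbourhood form — every `m < cn(v_{t₀})` stays `< cn(v_t)` for all
`t` with `|t - t₀| ≤ ρ`, for some `ρ > 0`. Nothing is assumed about `v`, `R`, `N`, `L`.

## Proof

* `cut_mono`, `cut_le_add` — the path is monotone and `1`-Lipschitz in the coupling, pointwise:
  `v_s ≤ v_t ≤ v_s + (t - s)` for `s ≤ t`;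
* `energy_le_add` (with the landed `CutToHardCore.energy_mono`) — hence
  `energy v_s Ψ ≤ energy v_t Ψ ≤ energy v_s Ψ + (t-s)·N²` (the interaction has at most `N²` pair
  terms and `∫ |Ψ|² = 1`), and the same sandwich for the ground-state energies (the landed
  `GroundStateRigidity.EnergyTrunc.groundStateEnergy_mono`, and `groundStateEnergy_le_add` via
  `ENNReal.iInf_add`);
* `nearMin_transfer_up`, `nearMin_transfer_down` — so a `δ`-near-minimiser of `v_t` is a
  `(δ + |t - t₀|·N²)`-near-minimiser of `v_{t₀}`;
* `stub_pathLsc` — order theory of `condensateNumber = ⨆_{δ>0} ⨅_{near-minimisers} λ_max`: from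
  `m < cn(v_{t₀})` pick `δ' > 0` with `m < I_{t₀}(δ')` (`lt_iSup_iff`), pick `ρ > 0` with
  `κ := ρ·N² < δ'` (`ENNReal.exists_nnreal_pos_mul_lt`), and use the slack `δ' - κ > 0` for `v_t`:
  its near-minimisers are `δ'`-near-minimisers of `v_{t₀}`, whence
  `m < I_{t₀}(δ') ≤ condensateNumber v_t N L` (`le_condensateNumber`).
-/

noncomputable section

namespace Summit.AtomisticToContinuum.BoseEinsteinCondensation.Cruxes.HardCoreDominates.Birth

open MeasureTheory Literature.MathematicalPhysics.QuantumManyBody.BoseGas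
open Summit.AtomisticToContinuum.BoseEinsteinCondensation.Theorems.GroundStateRigidity.EnergyTrunc
  (groundStateEnergy_mono)
open CutToHardCore (energy_mono)
open scoped ENNReal NNReal

namespace PathLsc

variable {N : ℕ} {L : ℝ}

/-- The coupling path `t ↦ v + t·1_{Iic R}` is pointwise monotone in the coupling. [folklore] -/
theorem cut_mono (v : ℝ → ℝ≥0∞) (R : ℝ) {s t : ℝ≥0} (hst : s ≤ t) (r : ℝ) :
    (v + Set.indicator (Set.Iic R) (fun _ : ℝ => (s : ℝ≥0∞))) r ≤
      (v + Set.indicator (Set.Iic R) (fun _ : ℝ => (t : ℝ≥0∞))) r := by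
  simp only [Pi.add_apply]
  exact add_le_add le_rfl (Set.indicator_le_indicator (ENNReal.coe_le_coe.2 hst))

/-- The coupling path is pointwise `1`-Lipschitz in the coupling (upper bound by the truncated
difference): `v_t ≤ v_s + (t - s)`. [folklore] -/
theorem cut_le_add (v : ℝ → ℝ≥0∞) (R : ℝ) (s t : ℝ≥0) (r : ℝ) :
    (v + Set.indicator (Set.Iic R) (fun _ : ℝ => (t : ℝ≥0∞))) r ≤
      (v + Set.indicator (Set.Iic R) (fun _ : ℝ => (s : ℝ≥0∞))) r + ((t - s : ℝ≥0) : ℝ≥0∞) := by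
  simp only [Pi.add_apply, add_assoc]
  refine add_le_add le_rfl ?_
  by_cases hr : r ∈ Set.Iic R
  · simp only [Set.indicator_of_mem hr, ← ENNReal.coe_add, ENNReal.coe_le_coe]
    exact le_add_tsub
  · simp only [Set.indicator_of_notMem hr]
    exact zero_le

/-- A uniform shift of the pair potential by `c` shifts the interaction by at most `c·N²`
(there are at most `N²` pair terms). [folklore] -/
theorem interaction_le_add {v w : ℝ → ℝ≥0∞} {c : ℝ≥0∞} (h : ∀ r, w r ≤ v r + c) (X : Config N) :
    interaction w X ≤ interaction v X + c * ((N : ℝ≥0∞) * N) := by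
  calc interaction w X
      ≤ ∑ i : Fin N, ∑ j : Fin N with i < j, (v (dist (X i) (X j)) + c) :=
        Finset.sum_le_sum fun i _ => Finset.sum_le_sum fun j _ => h _
    _ = interaction v X + ∑ i : Fin N, ∑ j : Fin N with i < j, c := by
        simp only [interaction, Finset.sum_add_distrib]
    _ ≤ interaction v X + ∑ _i : Fin N, ∑ _j : Fin N, c :=
        add_le_add le_rfl (Finset.sum_le_sum fun i _ =>
          Finset.sum_le_sum_of_subset (Finset.filter_subset _ _))
    _ = interaction v X + c * ((N : ℝ≥0∞) * N) := by
        simp only [Finset.sum_const, Finset.card_univ, Fintype.card_fin, nsmul_eq_mul]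
        ring

/-- A uniform shift of the pair potential by `c` shifts the energy of a (normalised) trial state
by at most `c·N²`. [folklore] -/
theorem energy_le_add {v w : ℝ → ℝ≥0∞} {c : ℝ≥0∞} (h : ∀ r, w r ≤ v r + c) (Ψ : TrialState N L) :
    energy w Ψ ≤ energy v Ψ + c * ((N : ℝ≥0∞) * N) := by
  have hm₂ : Measurable fun X => (‖Ψ.ψ X‖₊ : ℝ≥0∞) ^ 2 :=
    (Ψ.contDiff.continuous.measurable.nnnorm.coe_nnreal_ennreal).pow_const 2
  calc energy w Ψ
      ≤ ∫⁻ X, (kineticDensity Ψ.ψ X + interaction v X * (‖Ψ.ψ X‖₊ : ℝ≥0∞) ^ 2) +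
          c * ((N : ℝ≥0∞) * N) * (‖Ψ.ψ X‖₊ : ℝ≥0∞) ^ 2 := by
        refine lintegral_mono fun X => ?_
        rw [add_assoc, ← add_mul]
        exact add_le_add le_rfl (mul_le_mul' (interaction_le_add h X) le_rfl)
    _ = energy v Ψ + c * ((N : ℝ≥0∞) * N) := by
        rw [lintegral_add_right _ (hm₂.const_mul _), lintegral_const_mul _ hm₂, Ψ.norm_eq,
          mul_one]
        rfl

/-- A uniform shift of the pair potential by `c` shifts the ground-state energy by at most
`c·N²`. [folklore] -/
theorem groundStateEnergy_le_add {v w : ℝ → ℝ≥0∞} {c : ℝ≥0∞} (h : ∀ r, w r ≤ v r + c) :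
    groundStateEnergy w N L ≤ groundStateEnergy v N L + c * ((N : ℝ≥0∞) * N) := by
  unfold groundStateEnergy
  rw [ENNReal.iInf_add]
  exact iInf_mono fun Ψ => energy_le_add h Ψ

/-- **Transfer of near-minimisers, upwards.** If `v ≤ w ≤ v + c` pointwise, a `δ`-near-minimiser
of `v` is a `(δ + c·N²)`-near-minimiser of `w`. [folklore] -/
theorem nearMin_transfer_up {v w : ℝ → ℝ≥0∞} {c δ : ℝ≥0∞} (hle : ∀ r, v r ≤ w r)
    (hadd : ∀ r, w r ≤ v r + c) (Ψ : TrialState N L)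
    (hΨ : energy v Ψ ≤ groundStateEnergy v N L + δ) :
    energy w Ψ ≤ groundStateEnergy w N L + (δ + c * ((N : ℝ≥0∞) * N)) :=
  calc energy w Ψ
      ≤ energy v Ψ + c * ((N : ℝ≥0∞) * N) := energy_le_add hadd Ψ
    _ ≤ groundStateEnergy v N L + δ + c * ((N : ℝ≥0∞) * N) := add_le_add hΨ le_rfl
    _ ≤ groundStateEnergy w N L + δ + c * ((N : ℝ≥0∞) * N) :=
        add_le_add (add_le_add (groundStateEnergy_mono hle N L) le_rfl) le_rfl
    _ = groundStateEnergy w N L + (δ + c * ((N : ℝ≥0∞) * N)) := add_assoc _ _ _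

/-- **Transfer of near-minimisers, downwards.** If `v ≤ w ≤ v + c` pointwise, a
`δ`-near-minimiser of `w` is a `(δ + c·N²)`-near-minimiser of `v`. [folklore] -/
theorem nearMin_transfer_down {v w : ℝ → ℝ≥0∞} {c δ : ℝ≥0∞} (hle : ∀ r, v r ≤ w r)
    (hadd : ∀ r, w r ≤ v r + c) (Ψ : TrialState N L)
    (hΨ : energy w Ψ ≤ groundStateEnergy w N L + δ) :
    energy v Ψ ≤ groundStateEnergy v N L + (δ + c * ((N : ℝ≥0∞) * N)) :=
  calc energy v Ψ
      ≤ energy w Ψ := energy_mono hle Ψ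
    _ ≤ groundStateEnergy w N L + δ := hΨ
    _ ≤ groundStateEnergy v N L + c * ((N : ℝ≥0∞) * N) + δ :=
        add_le_add (groundStateEnergy_le_add hadd) le_rfl
    _ = groundStateEnergy v N L + (δ + c * ((N : ℝ≥0∞) * N)) := by
        rw [add_assoc, add_comm _ δ]

end PathLsc

open PathLsc in
/-- **Stub — PathLsc (lower semicontinuity of the condensate number in the finite coupling).**
For every profile `v`, range marker `R`, particle number `N`, side `L` and coupling `t₀`, every
`m < cn(v_{t₀})` stays below `cn(v_t)` for all couplings `t` with `|t - t₀| ≤ ρ`, for some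
`ρ > 0`. Mechanism: the energy is monotone and `N²`-Lipschitz in the coupling, so
`δ`-near-minimisers of `v_t` are `(δ + N²ρ)`-near-minimisers of `v_{t₀}`; order theory of
`⨆ δ ⨅`. [folklore] -/
theorem stub_pathLsc :
    ∀ (v : ℝ → ENNReal) (R : ℝ) (N : ℕ) (L : ℝ) (t₀ : NNReal) (m : ENNReal),
      m < Literature.MathematicalPhysics.QuantumManyBody.BoseGas.condensateNumber
            (v + Set.indicator (Set.Iic R) (fun _ : ℝ => (t₀ : ENNReal))) N L →
      ∃ ρ : NNReal, 0 < ρ ∧ ∀ t : NNReal, t₀ ≤ t + ρ → t ≤ t₀ + ρ →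
        m < Literature.MathematicalPhysics.QuantumManyBody.BoseGas.condensateNumber
              (v + Set.indicator (Set.Iic R) (fun _ : ℝ => (t : ENNReal))) N L := by
  intro v R N L t₀ m hm
  -- order theory: a slack level `δ' > 0` of `v_{t₀}` already above `m`
  obtain ⟨δ', hm⟩ := lt_iSup_iff.1 hm
  obtain ⟨hδ', hm⟩ := lt_iSup_iff.1 hm
  -- the radius: `κ := ρ·N² < δ'`
  obtain ⟨ρ, hρ, hκ⟩ := ENNReal.exists_nnreal_pos_mul_lt
    (ENNReal.mul_ne_top (ENNReal.natCast_ne_top N) (ENNReal.natCast_ne_top N)) hδ'.ne'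
  refine ⟨ρ, hρ, fun t h₁ h₂ => hm.trans_le ?_⟩
  -- the slack for `v_t`
  have hδ₁ : 0 < δ' - (ρ : ℝ≥0∞) * ((N : ℝ≥0∞) * N) := tsub_pos_iff_lt.2 hκ
  refine le_condensateNumber _ hδ₁ fun Ψ hΨ => iInf_maxOccupation_le _ Ψ ?_
  -- transfer of the near-minimiser `Ψ` of `v_t` to `v_{t₀}` at slack `δ'`
  rw [← tsub_add_cancel_of_le hκ.le]
  rcases le_total t t₀ with ht | ht
  · -- `t ≤ t₀ ≤ t + ρ`: transfer upwards along `v_t ≤ v_{t₀} ≤ v_t + (t₀ - t)`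
    have hc : (((t₀ - t : ℝ≥0)) : ℝ≥0∞) ≤ ρ := ENNReal.coe_le_coe.2 (tsub_le_iff_left.2 h₁)
    exact (nearMin_transfer_up (cut_mono v R ht) (cut_le_add v R t t₀) Ψ hΨ).trans
      (add_le_add le_rfl (add_le_add le_rfl (mul_le_mul' hc le_rfl)))
  · -- `t₀ ≤ t ≤ t₀ + ρ`: transfer downwards along `v_{t₀} ≤ v_t ≤ v_{t₀} + (t - t₀)`
    have hc : (((t - t₀ : ℝ≥0)) : ℝ≥0∞) ≤ ρ := ENNReal.coe_le_coe.2 (tsub_le_iff_left.2 h₂)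
    exact (nearMin_transfer_down (cut_mono v R ht) (cut_le_add v R t₀ t) Ψ hΨ).trans
      (add_le_add le_rfl (add_le_add le_rfl (mul_le_mul' hc le_rfl)))

end Summit.AtomisticToContinuum.BoseEinsteinCondensation.Cruxes.HardCoreDominates.Birth

end
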